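/-
Copyright (c) 2026. All rights reserved.
Released under Apache 2.0 license as described in the file LICENSE.
Authors: abc-iut cell, seat abc-iut-w5-d115 (gen 7).
-/
import Literature.GroupTheory.ProP.OperatorFrattiniOpen
import Literature.GroupTheory.StronglyCompleteWildReduction

/-!
# Strong completeness modulo a normally finitely generated pro-`p` subgroup (operator Serre)

Let `G` be a profinite group (compact, totally disconnected topological group) which is topologically
finitely generated, and let `P ⊴ G` be a CLOSED normal PRO-`p` subgroup which is the topological
normal closure of finitely many elements.  Assume

* (a) every finite-index subgroup `K ≥ P` of `G` is open (strong completeness of `G ⧸ P`).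

THEOREM (`isOpen_of_proP_normallyGenerated_of_sup_eq_top`).  Every normal subgroup `H` of finite
index with `H · P = G` and `G ⧸ H` a `p`-group is open.

This is the descent step which, combined with the elementary dévissage of
`StronglyCompleteWildReduction.lean` (seat abc-iut-w5-d006) and with the fact that abstract finite
quotients of pro-`p` groups are `p`-groups, shows that `G` itself is strongly complete
(sequel file).  It replaces the Nikolov–Segal theorem in the one instance the abc-iut cell needs
(`G = Gal(k̄/k)`, `k` a `p`-adic field, `P` the wild inertia; FACT F-1977, GAP G-L3d2g2-1), given
seat abc-iut-w6-d103's operator Serre lemma (`ProP/OperatorFrattiniOpen.lean`,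
`exists_openNormalSubgroup_inf_le_operatorFrattini`: the abstract subgroup
`⟨w ^ p, ⁅w, c⁆ : w ∈ P, c ∈ G⟩` is open in `P`).

PROOF.  Strong induction on `[G : H]` over the normal subgroups `H` with `H P = G`, carrying the
invariant «some finite `S ⊆ P ∩ H` has topological normal closure OPEN in `P`».  If `H ≠ G`, the
finite `p`-group `G ⧸ H` has a central element of order `p`; its preimage `H' ⊋ H` is normal, of
smaller index, with `⁅H', G⁆ ⊆ H` and `H'^p ⊆ H`.  By induction `H'` is open and carries the
invariant with a finite `S' ⊆ P ∩ H'`; the operator Serre lemma applied to the topological normal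
closure `P' = cl ncl(S')` (closed, normal, pro-`p`, open in `P`) gives an open normal `U₀` with
`U₀ ∩ P' ⊆ ⟨w ^ p, ⁅w, c⁆ : w ∈ P'⟩ ⊆ H`, so `H` contains `V ∩ P` for an open `V` and is open by the
dévissage `isOpen_of_finiteIndex_of_isOpen_inf_normal`; and the invariant propagates to `H` with
`S = {y ^ p, ⁅y, gⱼ⁆}` because the abstract operator-Frattini subgroup of `P'` is contained in the
topological normal closure of that finite set
(`operatorFrattini_le_topologicalClosure_normalClosure`: in the quotient the images of the `y` are
central — they commute with the topological generators `gⱼ` — of order dividing `p`, and generate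
a finite, hence closed, central subgroup containing the image of `P'`).

HONEST FRAMING: elementary profinite group theory (no Nikolov–Segal, no Segal 2000, no CFSG);
nothing here bears on [IUTchIII] Cor. 3.12 or asserts anything about abc.

## References
* J.-P. Serre, *Galois Cohomology*, I §4.2, exercise 6. [SerreGaloisCohomology1997]
* J. D. Dixon, M. du Sautoy, A. Mann, D. Segal, *Analytic pro-`p` groups*, 2nd ed., Ch. 1,
  Thm. 1.17. [DixonDuSautoyMannSegal1999]
* L. Ribes, P. Zalesskii, *Profinite Groups*, 2nd ed., §4.2. [RibesZalesskii2010]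
-/

namespace Literature.GroupTheory

open Subgroup Topology
open scoped commutatorElement Pointwise

universe u

variable {G : Type u} [Group G] [TopologicalSpace G] [IsTopologicalGroup G] [CompactSpace G]
  [TotallyDisconnectedSpace G]

/-! ### The operator-Frattini subgroup lies in the topological normal closure of `{y ^ p, ⁅y, gⱼ⁆}` -/

omit [CompactSpace G] [TotallyDisconnectedSpace G] in
/-- **Normal generators of the operator-Frattini subgroup.** Let `G` be topologically generated by
`g₁, …, g_d` and let `P` be the topological normal closure of `y₁, …, y_n`.  Then the abstract
operator-Frattini subgroup `⟨w ^ p, ⁅w, c⁆ : w ∈ P, c ∈ G⟩` is contained in the topological normal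
closure `N` of the FINITE set `{yₐ ^ p} ∪ {⁅yₐ, gⱼ⁆}`: in `G ⧸ N` (a `T₁` group) each `ȳₐ` commutes
with every `ḡⱼ`, hence — its centraliser being closed — with everything, so the `ȳₐ` generate a
central subgroup of exponent `p`, finite hence closed, which contains the image of `P`.
[cite: DixonDuSautoyMannSegal1999, Ch. 1 Thm. 1.17] -/
theorem operatorFrattini_le_topologicalClosure_normalClosure {p : ℕ} [hp : Fact p.Prime]
    {P : Subgroup G} {d : ℕ} {g : Fin d → G}
    (hg : (Subgroup.closure (Set.range g)).topologicalClosure = ⊤)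
    {n : ℕ} {y : Fin n → G} (hyP : (Subgroup.normalClosure (Set.range y)).topologicalClosure = P) :
    Subgroup.closure ({x : G | ∃ w ∈ P, w ^ p = x} ∪ {x : G | ∃ w ∈ P, ∃ c : G, ⁅w, c⁆ = x}) ≤
      (Subgroup.normalClosure ((Set.range fun a => y a ^ p) ∪
        (Set.range fun aj : Fin n × Fin d => ⁅y aj.1, g aj.2⁆))).topologicalClosure := by
  classical
  set Z : Set G := (Set.range fun a => y a ^ p) ∪
    (Set.range fun aj : Fin n × Fin d => ⁅y aj.1, g aj.2⁆) with hZ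
  set N : Subgroup G := (Subgroup.normalClosure Z).topologicalClosure with hN
  haveI hNn : N.Normal := Subgroup.is_normal_topologicalClosure _
  have hNc : IsClosed (N : Set G) := Subgroup.isClosed_topologicalClosure _
  have hZN : Z ⊆ N := fun z hz =>
    Subgroup.le_topologicalClosure _ (Subgroup.subset_normalClosure hz)
  set Q := G ⧸ N with hQ
  haveI : T1Space Q := (QuotientGroup.t1Space_iff (N := N)).mpr hNc
  -- (i) the images of the `yₐ` are central
  have hyc : ∀ a (q : Q), q * QuotientGroup.mk (y a) = QuotientGroup.mk (y a) * q := by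
    intro a
    set C : Subgroup Q := Subgroup.centralizer ({(QuotientGroup.mk (y a) : Q)} : Set Q) with hC
    have hCc : IsClosed (C : Set Q) := by
      have : (C : Set Q) =
          {q : Q | (QuotientGroup.mk (y a) : Q) * q = q * QuotientGroup.mk (y a)} := by
        ext q
        simp only [hC, SetLike.mem_coe, Subgroup.mem_centralizer_iff, Set.mem_singleton_iff,
          forall_eq, Set.mem_setOf_eq]
      rw [this]
      exact isClosed_eq (continuous_const_mul _) (continuous_mul_const _)
    have hgen : Subgroup.closure (Set.range g) ≤ C.comap (QuotientGroup.mk' N) := by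
      rw [Subgroup.closure_le]
      rintro _ ⟨j, rfl⟩
      rw [SetLike.mem_coe, Subgroup.mem_comap, hC, Subgroup.mem_centralizer_iff]
      rintro _ rfl
      -- `⁅y a, g j⁆ ∈ N`
      have hmem : ⁅y a, g j⁆ ∈ N := hZN (Or.inr ⟨(a, j), rfl⟩)
      have h1 : (QuotientGroup.mk' N ⁅y a, g j⁆ : Q) = 1 := (QuotientGroup.eq_one_iff _).mpr hmem
      rw [map_commutatorElement, commutatorElement_eq_one_iff_mul_comm, QuotientGroup.mk'_apply,
        QuotientGroup.mk'_apply] at h1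
      exact h1
    intro q
    obtain ⟨c, rfl⟩ := QuotientGroup.mk_surjective q
    have hc : c ∈ _root_.closure ((Subgroup.closure (Set.range g) : Subgroup G) : Set G) := by
      rw [← Subgroup.topologicalClosure_coe, hg]; trivial
    have hsub : (QuotientGroup.mk : G → Q) '' ((Subgroup.closure (Set.range g) : Subgroup G) : Set G)
        ⊆ (C : Set Q) := by
      rintro _ ⟨x, hx, rfl⟩
      exact hgen hx
    have hcC : (QuotientGroup.mk c : Q) ∈ C :=
      hCc.closure_subset_iff.mpr hsub (image_closure_subset_closure_image continuous_quotient_mk'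
        ⟨c, hc, rfl⟩)
    rw [hC, Subgroup.mem_centralizer_iff] at hcC
    exact (hcC _ rfl).symm
  -- (ii) the subgroup `A` generated by the `ȳₐ`: commutative, `p`-torsion, finite, closed, central
  set A : Subgroup Q := Subgroup.closure (Set.range fun a => (QuotientGroup.mk (y a) : Q)) with hA
  have hAcomm : ∀ b ∈ Set.range (fun a => (QuotientGroup.mk (y a) : Q)),
      ∀ b' ∈ Set.range (fun a => (QuotientGroup.mk (y a) : Q)), b * b' = b' * b := by
    rintro _ ⟨a, rfl⟩ b' -
    exact (hyc a b').symm
  haveI : IsMulCommutative A := Subgroup.isMulCommutative_closure hAcomm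
  have hApow : ∀ q ∈ A, q ^ p = 1 := by
    intro q hq
    induction hq using Subgroup.closure_induction with
    | mem x hx =>
      obtain ⟨a, rfl⟩ := hx
      rw [← QuotientGroup.mk_pow, QuotientGroup.eq_one_iff]
      exact hZN (Or.inl ⟨a, rfl⟩)
    | one => rw [one_pow]
    | mul x x' hx hx' ihx ihx' =>
      have hcomm : x * x' = x' * x :=
        congrArg Subtype.val (IsMulCommutative.is_comm.comm (⟨x, hx⟩ : A) ⟨x', hx'⟩)
      rw [(show Commute x x' from hcomm).mul_pow, ihx, ihx', one_mul]
    | inv x _ ihx => rw [inv_pow, ihx, inv_one]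
  haveI : Finite (Set.range fun a => (QuotientGroup.mk (y a) : Q)) := (Set.finite_range _).to_subtype
  have htors : Monoid.IsTorsion A := by
    intro q
    refine isOfFinOrder_iff_pow_eq_one.mpr ⟨p, hp.out.pos, ?_⟩
    exact Subtype.ext (hApow q.1 q.2)
  haveI : Finite A := by
    open scoped IsMulCommutative in
    exact CommGroup.finite_of_fg_torsion (G := A) htors
  have hAclosed : IsClosed (A : Set Q) := (Set.toFinite (A : Set Q)).isClosed
  have hAcentral : ∀ q ∈ A, ∀ c : Q, c * q * c⁻¹ = q := by
    intro q hq c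
    induction hq using Subgroup.closure_induction with
    | mem x hx =>
      obtain ⟨a, rfl⟩ := hx
      rw [hyc a c, mul_inv_cancel_right]
    | one => group
    | mul x x' _ _ hx hx' =>
      calc c * (x * x') * c⁻¹ = (c * x * c⁻¹) * (c * x' * c⁻¹) := by group
        _ = x * x' := by rw [hx, hx']
    | inv x _ hx =>
      calc c * x⁻¹ * c⁻¹ = (c * x * c⁻¹)⁻¹ := by group
        _ = x⁻¹ := by rw [hx]
  haveI hAN : A.Normal := ⟨fun q hq c => by rw [hAcentral q hq c]; exact hq⟩
  -- (iii) the image of `P` lies in `A`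
  have hPA : ∀ x ∈ P, (QuotientGroup.mk x : Q) ∈ A := by
    have h1 : (Subgroup.normalClosure (Set.range y)).map (QuotientGroup.mk' N) ≤ A := by
      rw [Subgroup.map_normalClosure _ _ (QuotientGroup.mk'_surjective N)]
      refine Subgroup.normalClosure_le_normal ?_
      rintro _ ⟨_, ⟨a, rfl⟩, rfl⟩
      exact Subgroup.subset_closure ⟨a, rfl⟩
    intro x hx
    rw [← hyP] at hx
    have hxc : x ∈ _root_.closure ((Subgroup.normalClosure (Set.range y) : Subgroup G) : Set G) := by
      rw [← Subgroup.topologicalClosure_coe]; exact hx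
    have himg : (QuotientGroup.mk x : Q) ∈ _root_.closure ((QuotientGroup.mk : G → Q) ''
        ((Subgroup.normalClosure (Set.range y) : Subgroup G) : Set G)) :=
      image_closure_subset_closure_image continuous_quotient_mk' ⟨x, hxc, rfl⟩
    have hsub : (QuotientGroup.mk : G → Q) ''
        ((Subgroup.normalClosure (Set.range y) : Subgroup G) : Set G) ⊆ (A : Set Q) := by
      rintro _ ⟨z, hz, rfl⟩
      exact h1 (Subgroup.mem_map_of_mem _ hz)
    exact hAclosed.closure_subset_iff.mpr hsub himg
  -- (iv) conclusion
  rw [Subgroup.closure_le]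
  rintro _ (⟨w, hw, rfl⟩ | ⟨w, hw, c, rfl⟩)
  · show w ^ p ∈ N
    rw [← QuotientGroup.eq_one_iff, QuotientGroup.mk_pow]
    exact hApow _ (hPA w hw)
  · show ⁅w, c⁆ ∈ N
    rw [← QuotientGroup.eq_one_iff]
    change (QuotientGroup.mk' N ⁅w, c⁆ : Q) = 1
    rw [map_commutatorElement, commutatorElement_eq_one_iff_mul_comm, QuotientGroup.mk'_apply,
      QuotientGroup.mk'_apply]
    have := hAcentral _ (hPA w hw) (QuotientGroup.mk c)
    exact (mul_inv_eq_iff_eq_mul.mp this).symm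

/-! ### The descent along central steps of order `p` -/

omit [TopologicalSpace G] [IsTopologicalGroup G] [CompactSpace G] [TotallyDisconnectedSpace G] in
/-- `⁅x, c⁆ ∈ P` for `x` in the normal subgroup `P`. [cite: RibesZalesskii2010, §4.2] -/
theorem commutatorElement_mem_of_mem_left (P : Subgroup G) [P.Normal] {x : G} (hx : x ∈ P) (c : G) :
    ⁅x, c⁆ ∈ P := by
  rw [commutatorElement_def, mul_assoc, mul_assoc]
  exact P.mul_mem hx (by
    simpa only [mul_assoc] using Subgroup.Normal.conj_mem inferInstance x⁻¹ (P.inv_mem hx) c)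

/-- **The descent (inductive form).** `G` profinite, topologically generated by `g₁, …, g_d`;
`P ⊴ G` closed, pro-`p`, containing a finite set `S₀` whose topological normal closure is open in
`P`; (a) every finite-index `K ≥ P` open.  Then for every normal finite-index `H` with `H ⊔ P = ⊤`
and `G ⧸ H` a `p`-group: `H` is open, AND `P ⊓ H` again contains a finite set whose topological
normal closure is open in `P` (strong induction on `[G : H]` along central steps of order `p`, each
step being abc-iut-w6-d103's operator Serre lemma `exists_openNormalSubgroup_inf_le_operatorFrattini`
plus the dévissage `isOpen_of_finiteIndex_of_isOpen_inf_normal`).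
[cite: DixonDuSautoyMannSegal1999, Ch. 1 Thm. 1.17] [cite: RibesZalesskii2010, §4.2] -/
theorem isOpen_and_exists_normalGenerators_of_sup_eq_top {p : ℕ} [hp : Fact p.Prime]
    {P : Subgroup G} [P.Normal] (hPc : IsClosed (P : Set G))
    (hP : ∀ x ∈ P, ∀ U : Subgroup G, IsOpen (U : Set G) → ∃ a : ℕ, x ^ (p ^ a) ∈ U)
    {d : ℕ} {g : Fin d → G} (hg : (Subgroup.closure (Set.range g)).topologicalClosure = ⊤)
    (hfng : ∃ S : Set G, S.Finite ∧ S ⊆ P ∧ ∃ W : Subgroup G, IsOpen (W : Set G) ∧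
      W ⊓ P ≤ (Subgroup.normalClosure S).topologicalClosure)
    (ha : ∀ K : Subgroup G, P ≤ K → K.FiniteIndex → IsOpen (K : Set G)) :
    ∀ (m : ℕ) (H : Subgroup G) [H.Normal] [H.FiniteIndex], H.index = m → H ⊔ P = ⊤ →
      IsPGroup p (G ⧸ H) →
      IsOpen (H : Set G) ∧ ∃ S : Set G, S.Finite ∧ S ⊆ P ⊓ H ∧ ∃ W : Subgroup G,
        IsOpen (W : Set G) ∧ W ⊓ P ≤ (Subgroup.normalClosure S).topologicalClosure := by
  intro m
  refine Nat.strong_induction_on m fun m ih => ?_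
  intro H _ _ hm hHP hQ
  classical
  by_cases hHtop : H = ⊤
  · subst hHtop
    refine ⟨by rw [Subgroup.coe_top]; exact isOpen_univ, ?_⟩
    obtain ⟨S, hSf, hSP, W, hW, hWP⟩ := hfng
    exact ⟨S, hSf, fun x hx => ⟨hSP hx, Subgroup.mem_top x⟩, W, hW, hWP⟩
  -- `G ⧸ H` is a nontrivial finite `p`-group: pick a central element `ζ` of order `p`
  haveI : Finite (G ⧸ H) := Subgroup.finite_quotient_of_finiteIndex
  haveI : Nontrivial (G ⧸ H) := by
    obtain ⟨x, hx⟩ : ∃ x : G, x ∉ H := not_forall.mp (mt (Subgroup.eq_top_iff' H).mpr hHtop)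
    exact ⟨⟨QuotientGroup.mk x, 1, fun h => hx ((QuotientGroup.eq_one_iff x).mp h)⟩⟩
  haveI : Nontrivial (Subgroup.center (G ⧸ H)) := hQ.center_nontrivial
  have hZp : IsPGroup p (Subgroup.center (G ⧸ H)) := hQ.to_subgroup _
  have hcard : p ∣ Nat.card (Subgroup.center (G ⧸ H)) := by
    rcases hZp.card_eq_or_dvd with h | h
    · exact absurd h Finite.one_lt_card.ne'
    · exact h
  obtain ⟨⟨ζ, hζmem⟩, hζc⟩ := exists_prime_orderOf_dvd_card' p hcard
  have hζord : orderOf ζ = p := by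
    rw [← hζc]
    exact Subgroup.orderOf_coe (⟨ζ, hζmem⟩ : Subgroup.center (G ⧸ H))
  have hζp : ζ ^ p = 1 := by rw [← hζord]; exact pow_orderOf_eq_one ζ
  have hzpc : ∀ x ∈ Subgroup.zpowers ζ, ∀ q : G ⧸ H, q * x = x * q := by
    intro x hx q
    have : x ∈ Subgroup.center (G ⧸ H) := (Subgroup.zpowers_le.mpr hζmem) hx
    exact Subgroup.mem_center_iff.mp this q
  haveI hzn : (Subgroup.zpowers ζ).Normal :=
    ⟨fun x hx c => by rw [hzpc x hx c, mul_inv_cancel_right]; exact hx⟩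
  -- `H' = ` preimage of `⟨ζ⟩`: normal, `H ≤ H'`, index `m / p`
  set H' : Subgroup G := (Subgroup.zpowers ζ).comap (QuotientGroup.mk' H) with hH'
  haveI hH'n : H'.Normal := Subgroup.Normal.comap hzn _
  have hHH' : H ≤ H' := by
    intro x hx
    rw [hH', Subgroup.mem_comap, QuotientGroup.mk'_apply, (QuotientGroup.eq_one_iff x).mpr hx]
    exact one_mem _
  haveI : H'.FiniteIndex := Subgroup.finiteIndex_of_le hHH'
  have hidx : H'.index * p = m := by
    have h1 : H'.index = (Subgroup.zpowers ζ).index :=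
      (Subgroup.zpowers ζ).index_comap_of_surjective (QuotientGroup.mk'_surjective H)
    have h2 : (Subgroup.zpowers ζ).index * Nat.card (Subgroup.zpowers ζ) = Nat.card (G ⧸ H) :=
      (Subgroup.zpowers ζ).index_mul_card
    rw [Nat.card_zpowers, hζord] at h2
    rw [h1, h2, ← Subgroup.index_eq_card, hm]
  have hlt : H'.index < m := by
    have hpos : 0 < H'.index := Nat.pos_of_ne_zero Subgroup.FiniteIndex.index_ne_zero
    have hp2 : 2 ≤ p := hp.out.two_le
    calc H'.index < H'.index * 2 := by omega
      _ ≤ H'.index * p := Nat.mul_le_mul_left _ hp2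
      _ = m := hidx
  have hH'P : H' ⊔ P = ⊤ := top_le_iff.mp (hHP ▸ sup_le_sup_right hHH' P)
  have hQ' : IsPGroup p (G ⧸ H') := by
    intro x
    obtain ⟨c, rfl⟩ := QuotientGroup.mk_surjective x
    obtain ⟨k, hk⟩ := hQ (QuotientGroup.mk c)
    refine ⟨k, ?_⟩
    rw [← QuotientGroup.mk_pow, QuotientGroup.eq_one_iff] at hk ⊢
    exact hHH' hk
  obtain ⟨hH'o, S', hS'f, hS'PH, W', hW'o, hW'P⟩ := ih H'.index hlt H' rfl hH'P hQ'
  -- the step `H ≤ H'` is central of exponent `p`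
  have hcommH : ∀ x ∈ H', ∀ c : G, ⁅x, c⁆ ∈ H := by
    intro x hx c
    rw [hH', Subgroup.mem_comap, QuotientGroup.mk'_apply] at hx
    rw [← QuotientGroup.eq_one_iff]
    change (QuotientGroup.mk' H ⁅x, c⁆ : G ⧸ H) = 1
    rw [map_commutatorElement, commutatorElement_eq_one_iff_mul_comm, QuotientGroup.mk'_apply,
      QuotientGroup.mk'_apply]
    exact (hzpc _ hx _).symm
  have hpowH : ∀ x ∈ H', x ^ p ∈ H := by
    intro x hx
    rw [hH', Subgroup.mem_comap, QuotientGroup.mk'_apply, Subgroup.mem_zpowers_iff] at hx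
    obtain ⟨k, hk⟩ := hx
    rw [← QuotientGroup.eq_one_iff, QuotientGroup.mk_pow, ← hk, ← zpow_natCast, ← zpow_mul,
      mul_comm, zpow_mul, zpow_natCast, hζp, one_zpow]
  -- `P' = cl ncl S'`: closed, normal, pro-`p`, inside `P ⊓ H'`, open in `P`
  set P' : Subgroup G := (Subgroup.normalClosure S').topologicalClosure with hP'
  haveI hP'n : P'.Normal := Subgroup.is_normal_topologicalClosure _
  have hP'c : IsClosed (P' : Set G) := Subgroup.isClosed_topologicalClosure _
  have hP'le : P' ≤ P ⊓ H' :=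
    Subgroup.topologicalClosure_minimal _ (Subgroup.normalClosure_le_normal hS'PH)
      (hPc.inter (Subgroup.isClosed_of_isOpen H' hH'o))
  have hP'P : P' ≤ P := fun x hx => (hP'le hx).1
  have hP'H' : P' ≤ H' := fun x hx => (hP'le hx).2
  have hP'el : ∀ x ∈ P', ∀ U : Subgroup G, IsOpen (U : Set G) → ∃ a : ℕ, x ^ (p ^ a) ∈ U :=
    fun x hx => hP x (hP'P hx)
  obtain ⟨n', y', hy'⟩ := hS'f.fin_embedding
  have hy'P : (Subgroup.normalClosure (Set.range (y' : Fin n' → G))).topologicalClosure = P' := by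
    rw [hy']
  have hy'mem : ∀ a, (y' : Fin n' → G) a ∈ P' := fun a =>
    Subgroup.le_topologicalClosure _ (Subgroup.subset_normalClosure (hy' ▸ ⟨a, rfl⟩))
  -- abc-iut-w6-d103's operator Serre lemma for `P'`
  obtain ⟨U₀, hU₀⟩ := Literature.GroupTheory.ProP.exists_openNormalSubgroup_inf_le_operatorFrattini
    hP'c hP'el hg hy'mem hy'P
  have hM'H : Subgroup.closure ({x : G | ∃ w ∈ P', w ^ p = x} ∪
      {x : G | ∃ w ∈ P', ∃ c : G, ⁅w, c⁆ = x}) ≤ H := by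
    rw [Subgroup.closure_le]
    rintro _ (⟨w, hw, rfl⟩ | ⟨w, hw, c, rfl⟩)
    · exact hpowH w (hP'H' hw)
    · exact hcommH w (hP'H' hw) c
  -- `H` is open
  have hV : IsOpen (((U₀ : Subgroup G) ⊓ W' : Subgroup G) : Set G) := U₀.isOpen.inter hW'o
  have hVP : ((U₀ : Subgroup G) ⊓ W') ⊓ P ≤ H := by
    rintro x ⟨⟨hxU, hxW⟩, hxP⟩
    exact hM'H (hU₀ ⟨hxU, hW'P ⟨hxW, hxP⟩⟩)
  have hHo : IsOpen (H : Set G) := isOpen_of_finiteIndex_of_isOpen_inf_normal P ha H _ hV hVP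
  refine ⟨hHo, (Set.range fun a => (y' : Fin n' → G) a ^ p) ∪
    (Set.range fun aj : Fin n' × Fin d => ⁅(y' : Fin n' → G) aj.1, g aj.2⁆),
    (Set.finite_range _).union (Set.finite_range _), ?_, (U₀ : Subgroup G) ⊓ W', hV, ?_⟩
  · rintro _ (⟨a, rfl⟩ | ⟨aj, rfl⟩)
    · exact ⟨P.pow_mem (hP'P (hy'mem a)) p, hpowH _ (hP'H' (hy'mem a))⟩
    · exact ⟨commutatorElement_mem_of_mem_left P (hP'P (hy'mem aj.1)) _,
        hcommH _ (hP'H' (hy'mem aj.1)) _⟩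
  · rintro x ⟨⟨hxU, hxW⟩, hxP⟩
    exact operatorFrattini_le_topologicalClosure_normalClosure (p := p) hg hy'P
      (hU₀ ⟨hxU, hW'P ⟨hxW, hxP⟩⟩)

/-- **Operator Serre descent.** Let `G` be a profinite group topologically generated by
`g₁, …, g_d`, `P ⊴ G` a closed normal pro-`p` subgroup which is the topological normal closure of
finitely many elements `y₁, …, y_n`, and assume (a): every finite-index subgroup `K ≥ P` is open.
Then every normal subgroup `H` of finite index with `H ⊔ P = ⊤` and `G ⧸ H` a `p`-group is OPEN.
(With the dévissage of `StronglyCompleteWildReduction.lean` and "abstract finite quotients of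
pro-`p` groups are `p`-groups", this yields the strong completeness of `G`; for `G = Gal(k̄/k)`,
`k` a `p`-adic field, and `P` the wild inertia it is the FACT F-1977 instance of the abc-iut cell,
modulo the normal finite generation of `P` and (a) for the tame quotient.)
[cite: DixonDuSautoyMannSegal1999, Ch. 1 Thm. 1.17] [cite: RibesZalesskii2010, §4.2] -/
theorem isOpen_of_proP_normallyGenerated_of_sup_eq_top {p : ℕ} [Fact p.Prime]
    {P : Subgroup G} [P.Normal] (hPc : IsClosed (P : Set G))
    (hP : ∀ x ∈ P, ∀ U : Subgroup G, IsOpen (U : Set G) → ∃ a : ℕ, x ^ (p ^ a) ∈ U)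
    {d : ℕ} {g : Fin d → G} (hg : (Subgroup.closure (Set.range g)).topologicalClosure = ⊤)
    {n : ℕ} {y : Fin n → G} (hy : ∀ a, y a ∈ P)
    (hyP : (Subgroup.normalClosure (Set.range y)).topologicalClosure = P)
    (ha : ∀ K : Subgroup G, P ≤ K → K.FiniteIndex → IsOpen (K : Set G))
    (H : Subgroup G) [H.Normal] [H.FiniteIndex] (hHP : H ⊔ P = ⊤) (hQ : IsPGroup p (G ⧸ H)) :
    IsOpen (H : Set G) :=
  (isOpen_and_exists_normalGenerators_of_sup_eq_top hPc hP hg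
    ⟨Set.range y, Set.finite_range y, by rintro _ ⟨a, rfl⟩; exact hy a, ⊤,
      by rw [Subgroup.coe_top]; exact isOpen_univ, by rw [hyP]; exact inf_le_right⟩
    ha H.index H rfl hHP hQ).1

end Literature.GroupTheory
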